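import Literature.NumberTheory.Automorphic.Liu2021.AppendixC.TowerMorphismAlbaneseComparison
import Literature.NumberTheory.Automorphic.Liu2021.AppendixC.OmegaHomBettiComparisonRank
import HarnessLib

/-!
# [Liu 2021, Thm. 4.15 proof, steps (S3)–(S4)] the seesaw detection in ÉTALE currency reduces to ONE Betti detection on the
# variety — the generic spine of clause (1) of `S34SomeSource` (pinning-free on the source)

Topic `NumberTheory/Automorphic/Liu2021/AppendixC`; namespace `Literature.NumberTheory.Automorphic.Liu2021.AppendixC`.
Continuation of `TowerMorphismBettiComparison.lean` (G7: `(1 ⊗ etPull) ∘ cmp = cmpₛ ∘ bettiPull`, pinning-free level form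
`baseChange_etPull_cmpLevel_eq_zero_iff (hinj)`), `TowerMorphismAlbaneseComparison.lean` (G7b: Lemma 2.4 (1) along `Sh(φ)_K`) and
`OmegaHomBettiComparisonRank.lean` (`BettiComparison.exists_comp_eq`: every `f ∈ Hom_{ℚ_ℓ^{ac}[𝔾]}(ι∘ω, ℚ_ℓ^{ac} ⊗ H¹_ét(A_∞))` is
`cmp ∘ fB`).  Clause (1) of the tree's seesaw input `S34SomeSource` (`SeesawSource.lean`, NOT imported or restated here) asks, for
`f ≠ 0`, for a source `s` with `((s.M.toEtaleTowerHom.etPull ℓ).baseChange ℚ_ℓ^{ac}).comp f ≠ 0`; print (p. 51, l. 2199–2213) gets it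
from a BETTI statement about ONE class of ONE variety («the image of `c` under the restriction map … is nonzero», after
[MurtyRamakrishnan1992] Prop. 6; tree row III-8′).  The GENERIC SPINE between the two:
* §1 a non-zero `f` takes, at some `w ∈ ω`, the value `cmp (b_K y)` of a level class `y` whose VARIETY class `cmp_{X_K} y` is non-zero
  (comparison ★, `exhaust`, Lemma 2.4 (1) injectivity);
* §2 PINNING-FREE ON THE SOURCE: for ANY `M : TowerHom` whose source has injective étale transition pull-backs — hypothesis `hIₛ`,
  which a curve source feeds from `Epi (Alb_{u⋆})` by ★ `AbelianVariety.injective_dualMap_rationalTateModuleMap_of_epi` (the GS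
  programme's `albTransitionEpi_GS`; no GS file imported) — a Betti detection `(Sh(φ)_K ×_{τ'} ℂ)^* (cmp_{X_K} y) ≠ 0` forces
  `((1 ⊗ M.toEtaleTowerHom.etPull)).comp f ≠ 0`;
* §3 packaged: `Sec42Data.BettiPinning.exists_scheme_class_detecting`.
A consumer closing the clause then owes exactly: the detection fact on the relevant piece of `X_K(ℂ)`, a source through it, and the
junction `(Sh(φ)_K ×_{τ'} ℂ)^* c ≠ 0` — nothing étale, no source pinning.  THEOREMS ONLY (0 def / 0 fact / 0 instance / 0 sorry);
`cA : AlbaneseH1ComparisonFamily E τ'` and the target pinning `B` are hypotheses.  Cell `hodgecm-mathlib`, line `a3_liu418`, GS-7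
spine.  HC_CM is proved only modulo the 7 printed citations until rung 0 closes; this file discharges none of them by itself.
References: [Liu2021] (`FJcycle.tex`) §4.3 l. 2152–2165, Thm. 4.15 proof l. 2185–2213 with fn. 9, Lem. 2.4 (1) l. 1210–1213;
[MurtyRamakrishnan1992] Prop. 6 (through Liu's fn. 9; not held); [SGA4Tome3] Exp. XI Thm. 4.4.
-/

set_option autoImplicit false

noncomputable section

open CategoryTheory NumberField Function
open scoped TensorProduct

namespace Literature.NumberTheory.Automorphic.Liu2021.AppendixC

open Literature.AlgebraicGeometry.Motives (AbelianVariety)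
open Literature.AlgebraicGeometry.Motives.AbelianVariety (rationalTateModuleMap)

variable {F E : Type} [Field F] [NumberField F] [IsTotallyReal F] [Field E] [NumberField E] [Algebra F E]
  [IsTotallyComplex E] [Algebra.IsQuadraticExtension F E]
variable {P5ₛ P5 : PropC5Data F E} {isoₛ iso : ℕ → Prop}
variable {Cₛ : Sec42Data P5ₛ isoₛ} {C : Sec42Data P5 iso} {Tₛ : Cₛ.HeckeTranslates} {T : C.HeckeTranslates}
  {φ : Cₛ.G →* C.G} {hφ : Continuous φ} {ℓ : ℕ} [Fact ℓ.Prime] {X : C.EtaleHeckeDatum ℓ}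
variable {τ' : E →+* ℂ} {H : Type} [AddCommGroup H] [Module ℂ H] {rhoB : Representation ℂ C.G H}
  (B : C.BettiPinning T τ' H rhoB) (ι : ℂ ≃+* AlgebraicClosure ℚ_[ℓ]) (c : H1ComparisonFamily (E := E) τ' ℓ ι)
  (cA : AlbaneseH1ComparisonFamily E τ')
variable {W : Type} [AddCommGroup W] [Module ℂ W] {ρW : Representation ℂ C.G W}
  {f : W →ₛₗ[(ι : ℂ →+* AlgebraicClosure ℚ_[ℓ])] AlgebraicClosure ℚ_[ℓ] ⊗[ℚ_[ℓ]] C.etaleH1Tower ℓ}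

/-! ## §1 A non-zero Hom-space element has a non-zero level class value -/

/-- **A non-zero `f ∈ Hom_{ℚ_ℓ^{ac}[𝔾]}(ι∘ω, ℚ_ℓ^{ac} ⊗ H¹_ét(A_∞))` takes a value `cmp (b_K y)` with `y ≠ 0`** at some `w ∈ ω` (`X`
induced by the translates, Betti tower pinned by `B`): `f = cmp ∘ fB` (★ `exists_comp_eq` over ★ `bettiComparisonAlong hX`), `f w ≠ 0`
for some `w`, `fB w` is a level class (`exhaust`). [cite: Liu2021, §4.3 (FJcycle.tex l. 2152–2165) and Thm. 4.15 proof l. 2185–2199] [cite: SGA4Tome3, Exp. XI Thm. 4.4] -/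
theorem Sec42Data.BettiPinning.exists_level_class_of_mem_omegaHom_ne_zero (hX : X.IsInducedBy T) (hf : f ∈ X.omegaHom ι ρW)
    (hf0 : f ≠ 0) : ∃ (w : W) (K : C5.SmallLevel C.S.K₀) (y : C.bettiH1 τ' K), f w = B.cmpAlong ℓ ι c (B.b K y) ∧ y ≠ 0 := by
  obtain ⟨φB, hφ⟩ := (B.bettiComparisonAlong ℓ ι c hX).exists_comp_eq ρW hf
  obtain ⟨w, hw⟩ : ∃ w, f w ≠ 0 := by
    by_contra h
    push Not at h
    exact hf0 (LinearMap.ext fun w => by rw [h w, LinearMap.zero_apply])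
  obtain ⟨K, y, hy⟩ := B.exhaust (φB w)
  have hfw : f w = B.cmpAlong ℓ ι c (B.b K y) := by
    rw [← hφ, LinearMap.comp_apply, Representation.IntertwiningMap.toLinearMap_apply, ← hy]
    rfl
  refine ⟨w, K, y, hfw, ?_⟩
  rintro rfl
  exact hw (by rw [hfw, map_zero, map_zero])

/-! ## §2 Pinning-free on the source: a Betti detection on the varieties forces the étale clause -/

/-- **PINNING-FREE TRANSFER**: if the source has injective étale transition pull-backs `ᵗV_ℓ(Alb_{u⋆})` (`hIₛ`; e.g. from `Epi (Alb_{u⋆})`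
by ★ `injective_dualMap_rationalTateModuleMap_of_epi`), a Betti detection `(Sh(φ)_K ×_{τ'} ℂ)^* (cmp_{X_K} y) ≠ 0` on the VARIETIES forces
`(1 ⊗ etPull) (cmp (b_K y)) ≠ 0` (G7 `baseChange_etPull_cmpLevel_eq_zero_iff` with `hinj := toTower_injective hIₛ` + G7b); no source pinning.
[cite: Liu2021, Thm. 4.15 proof (FJcycle.tex l. 2199–2213); Lem. 2.4 (1); §4.3 l. 2154–2160] [cite: SGA4Tome3, Exp. XI Thm. 4.4] -/
theorem Sec42Data.EtaleTowerHom.baseChange_etPull_cmpAlong_b_ne_zero_of_scheme (M : Sec42Data.EtaleTowerHom Cₛ C Tₛ T φ hφ)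
    (hIₛ : ∀ ⦃K K' : C5.SmallLevel Cₛ.S.K₀⦄ (u : K' ⟶ K), Injective (rationalTateModuleMap ℓ (Cₛ.Atr u)).dualMap)
    {K : C5.SmallLevel C.S.K₀} {y : C.bettiH1 τ' K} (h : schemeBettiPullAlong τ' (M.map K) (cA.cmp (C.X K) (C.alb K) y) ≠ 0) :
    (M.etPull ℓ).baseChange (AlgebraicClosure ℚ_[ℓ]) (B.cmpAlong ℓ ι c (B.b K y)) ≠ 0 := by
  rw [B.cmpAlong_b, ← BettiPinning.cmpLevel_apply, Ne,
    M.baseChange_etPull_cmpLevel_eq_zero_iff ℓ ι c K (Cₛ.toTower_injective ℓ hIₛ (M.src K)) y,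
    M.toTowerHom.bettiPullAlong_albMap_eq_zero_iff cA K y]
  exact h

/-- **CLAUSE (1) FROM ONE DETECTION** (the form `S34SomeSource` quantifies, for the lifted receptacle of a GEOMETRIC `M : TowerHom …`):
if `f w = cmp (b_K y)` and `M` detects the variety class `cmp_{X_K} y` in Betti cohomology, then
`((M.toEtaleTowerHom.etPull ℓ).baseChange ℚ_ℓ^{ac}).comp f ≠ 0` — granted only `hIₛ` on the source.
[cite: Liu2021, Thm. 4.15 proof (FJcycle.tex l. 2199–2213)] [cite: SGA4Tome3, Exp. XI Thm. 4.4] -/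
theorem Sec42Data.TowerHom.baseChange_etPull_toEtaleTowerHom_comp_ne_zero_of_scheme (M : Sec42Data.TowerHom Cₛ C Tₛ T φ hφ)
    (hIₛ : ∀ ⦃K K' : C5.SmallLevel Cₛ.S.K₀⦄ (u : K' ⟶ K), Injective (rationalTateModuleMap ℓ (Cₛ.Atr u)).dualMap)
    {w : W} {K : C5.SmallLevel C.S.K₀} {y : C.bettiH1 τ' K} (hwy : f w = B.cmpAlong ℓ ι c (B.b K y))
    (h : schemeBettiPullAlong τ' (M.map K) (cA.cmp (C.X K) (C.alb K) y) ≠ 0) :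
    ((M.toEtaleTowerHom.etPull ℓ).baseChange (AlgebraicClosure ℚ_[ℓ])).comp f ≠ 0 := by
  intro h0
  apply M.toEtaleTowerHom.baseChange_etPull_cmpAlong_b_ne_zero_of_scheme B ι c cA hIₛ h
  rw [← hwy, ← LinearMap.comp_apply, h0, LinearMap.zero_apply]

/-! ## §3 The spine packaged: every non-zero `f` has a detecting triple `(w, K, z)` -/

/-- **THE GENERIC SPINE OF CLAUSE (1) OF `S34SomeSource`**: for every non-zero `f` (étale Hecke datum induced by the translates, Betti tower
pinned by `B`, comparison families `c`, `cA`) there are `w ∈ ω`, a small level `K` and a NON-ZERO variety class `z ∈ H¹((X_K ×_{τ'} ℂ)(ℂ); ℂ)`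
with `f w = cmp (b_K (cmp_{X_K}⁻¹ z))` such that EVERY morphism of towers `M` into `C`'s tower with injective source transition pull-backs
that detects `z` — `(Sh(φ)_K ×_{τ'} ℂ)^* z ≠ 0` — satisfies `((1 ⊗ M.toEtaleTowerHom.etPull)).comp f ≠ 0`.  Print: the theorem «follows from
the above claim» (restriction to `Sh(G⋆,h⋆)`) applied to ONE class `c` detected by [MR92, Prop. 6] (p. 51, l. 2199–2213).
[cite: Liu2021, Thm. 4.15 proof (FJcycle.tex l. 2199–2213) with fn. 9; §4.3 l. 2152–2165; Lem. 2.4 (1)]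
[cite: MurtyRamakrishnan1992, Prop. 6 (through Liu2021 fn. 9)] [cite: SGA4Tome3, Exp. XI Thm. 4.4] -/
theorem Sec42Data.BettiPinning.exists_scheme_class_detecting (hX : X.IsInducedBy T) (hf : f ∈ X.omegaHom ι ρW) (hf0 : f ≠ 0) :
    ∃ (w : W) (K : C5.SmallLevel C.S.K₀) (z : schemeBettiH1Along (C.X K) τ'), z ≠ 0 ∧
      f w = B.cmpAlong ℓ ι c (B.b K ((cA.cmpEquiv (C.X K) (C.alb K) (C.cpt.smooth_X K) (C.cpt.projective_X K)).symm z)) ∧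
      ∀ {P5ₛ : PropC5Data F E} {isoₛ : ℕ → Prop} {Cₛ : Sec42Data P5ₛ isoₛ} {Tₛ : Cₛ.HeckeTranslates}
        {φ : Cₛ.G →* C.G} {hφ : Continuous φ} (M : Sec42Data.TowerHom Cₛ C Tₛ T φ hφ),
        (∀ ⦃L L' : C5.SmallLevel Cₛ.S.K₀⦄ (u : L' ⟶ L), Injective (rationalTateModuleMap ℓ (Cₛ.Atr u)).dualMap) →
        schemeBettiPullAlong τ' (M.map K) z ≠ 0 →
          ((M.toEtaleTowerHom.etPull ℓ).baseChange (AlgebraicClosure ℚ_[ℓ])).comp f ≠ 0 := by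
  obtain ⟨w, K, y, hfw, hy⟩ := B.exists_level_class_of_mem_omegaHom_ne_zero ι c hX hf hf0
  have hz : cA.cmp (C.X K) (C.alb K) y ≠ 0 := fun h =>
    hy ((map_eq_zero_iff _ (cA.cmp_injective (C.X K) (C.alb K) (C.cpt.smooth_X K) (C.cpt.projective_X K))).1 h)
  refine ⟨w, K, cA.cmp (C.X K) (C.alb K) y, hz, ?_, fun M hIₛ h => ?_⟩
  · rw [← AlbaneseH1ComparisonFamily.cmpEquiv_apply cA (C.X K) (C.alb K) (C.cpt.smooth_X K) (C.cpt.projective_X K),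
      LinearEquiv.symm_apply_apply]
    exact hfw
  · exact M.baseChange_etPull_toEtaleTowerHom_comp_ne_zero_of_scheme B ι c cA hIₛ hfw h

end Literature.NumberTheory.Automorphic.Liu2021.AppendixC

end

/-! ## §4 (appended) The same spine over PER-LEVEL comparison data — no `AlbaneseH1ComparisonFamily` inhabitant needed

The hypothesis structure `AlbaneseH1ComparisonFamily E τ'` of §1–§3 asks for ONE comparison for EVERY `(X, a)`, bijective on EVERY
smooth projective `X` — in the tree it is inhabited only through the named fact `Liu2021.albanese_bettiOne_pullback_bijective`
([Liu2021] Lem. 2.4 (1) for all proper smooth `X`).  A consumer that holds Lemma 2.4 (1) only AT ITS OWN LEVELS (the unconditional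
`albaneseH1Cmp X a` with its unconditional naturality `albaneseH1Cmp_natural`, and bijectivity at the levels it can prove) feeds the
primed variants below instead: the two level comparisons `cmpT` (target level `X_K`), `cmpS` (source level `X⋆_{φ⁻¹K ∩ K₀⋆}`) —
at the cell's face both are `albaneseH1Cmp`; their naturality square `hnat` at `(Sh(φ)_K, Alb(Sh(φ)_K))` — fed by `albaneseH1Cmp_natural`
with `nv := Nabla.map …` (★ `Nabla.map_incl`) and `hφ := TowerHom.α_albMap` exactly as §1 of `TowerMorphismAlbaneseComparison.lean`
feeds the family; `hinjS` — injectivity of `cmpS` (on the cone's levels bijectivity is the projective per-piece Lemma 2.4 (1) ★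
`albanese_bettiOne_pullback_bijective_of_isProjectiveOver` through the `…_of_lemma24Proj` heads, no named fact; on a curve source the
curve case); and `hIₛ` as in §2.  THEOREMS ONLY; no face / GS import. -/

noncomputable section

open CategoryTheory NumberField Function
open scoped TensorProduct

namespace Literature.NumberTheory.Automorphic.Liu2021.AppendixC

open Literature.AlgebraicGeometry.Motives (AbelianVariety)
open Literature.AlgebraicGeometry.Motives.AbelianVariety (rationalTateModuleMap)

variable {F E : Type} [Field F] [NumberField F] [IsTotallyReal F] [Field E] [NumberField E] [Algebra F E]
  [IsTotallyComplex E] [Algebra.IsQuadraticExtension F E]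
variable {P5ₛ P5 : PropC5Data F E} {isoₛ iso : ℕ → Prop}
variable {Cₛ : Sec42Data P5ₛ isoₛ} {C : Sec42Data P5 iso} {Tₛ : Cₛ.HeckeTranslates} {T : C.HeckeTranslates}
  {φ : Cₛ.G →* C.G} {hφ : Continuous φ} {ℓ : ℕ} [Fact ℓ.Prime] {X : C.EtaleHeckeDatum ℓ}
variable {τ' : E →+* ℂ} {H : Type} [AddCommGroup H] [Module ℂ H] {rhoB : Representation ℂ C.G H}
  (B : C.BettiPinning T τ' H rhoB) (ι : ℂ ≃+* AlgebraicClosure ℚ_[ℓ]) (c : H1ComparisonFamily (E := E) τ' ℓ ι)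
variable {W : Type} [AddCommGroup W] [Module ℂ W] {ρW : Representation ℂ C.G W}
  {f : W →ₛₗ[(ι : ℂ →+* AlgebraicClosure ℚ_[ℓ])] AlgebraicClosure ℚ_[ℓ] ⊗[ℚ_[ℓ]] C.etaleH1Tower ℓ}

/-- **Albanese ↔ variety nonvanishing from ONE naturality square**: with level comparisons `cmpT`, `cmpS` natural at
`(Sh(φ)_K, Alb(Sh(φ)_K))` and `cmpS` injective, `Alb(Sh(φ)_K)^* y = 0 ↔ (Sh(φ)_K ×_{τ'} ℂ)^* (cmpT y) = 0`.
[cite: Liu2021, Lem. 2.4 (1) (FJcycle.tex l. 1210–1213) with Def. 2.3 (l. 1206–1208); Thm. 4.15 proof l. 2212] -/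
theorem Sec42Data.TowerHom.bettiPullAlong_albMap_eq_zero_iff' (M : Sec42Data.TowerHom Cₛ C Tₛ T φ hφ)
    {K : C5.SmallLevel C.S.K₀} (cmpT : C.bettiH1 τ' K →ₗ[ℂ] schemeBettiH1Along (C.X K) τ')
    (cmpS : Cₛ.bettiH1 τ' (M.src K) →ₗ[ℂ] schemeBettiH1Along (Cₛ.X (M.src K)) τ')
    (hnat : ∀ y, cmpS (bettiPullAlong τ' (M.albMap K) y) = schemeBettiPullAlong τ' (M.map K) (cmpT y))
    (hinjS : Injective cmpS) (y : C.bettiH1 τ' K) :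
    bettiPullAlong τ' (M.albMap K) y = 0 ↔ schemeBettiPullAlong τ' (M.map K) (cmpT y) = 0 := by
  rw [← hnat, map_eq_zero_iff _ hinjS]

/-- **PINNING-FREE TRANSFER, per-level form**: `hIₛ` on the source + the naturality square + `cmpS` injective turn a Betti detection
`(Sh(φ)_K ×_{τ'} ℂ)^* (cmpT y) ≠ 0` into `(1 ⊗ etPull) (cmp (b_K y)) ≠ 0`. [cite: Liu2021, Thm. 4.15 proof (FJcycle.tex l. 2199–2213); §4.3 l. 2154–2160]
[cite: SGA4Tome3, Exp. XI Thm. 4.4] -/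
theorem Sec42Data.EtaleTowerHom.baseChange_etPull_cmpAlong_b_ne_zero_of_scheme' (M : Sec42Data.EtaleTowerHom Cₛ C Tₛ T φ hφ)
    (hIₛ : ∀ ⦃K K' : C5.SmallLevel Cₛ.S.K₀⦄ (u : K' ⟶ K), Injective (rationalTateModuleMap ℓ (Cₛ.Atr u)).dualMap)
    {K : C5.SmallLevel C.S.K₀} (cmpT : C.bettiH1 τ' K →ₗ[ℂ] schemeBettiH1Along (C.X K) τ')
    (cmpS : Cₛ.bettiH1 τ' (M.src K) →ₗ[ℂ] schemeBettiH1Along (Cₛ.X (M.src K)) τ')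
    (hnat : ∀ y, cmpS (bettiPullAlong τ' (M.albMap K) y) = schemeBettiPullAlong τ' (M.map K) (cmpT y))
    (hinjS : Injective cmpS) {y : C.bettiH1 τ' K} (h : schemeBettiPullAlong τ' (M.map K) (cmpT y) ≠ 0) :
    (M.etPull ℓ).baseChange (AlgebraicClosure ℚ_[ℓ]) (B.cmpAlong ℓ ι c (B.b K y)) ≠ 0 := by
  rw [B.cmpAlong_b, ← BettiPinning.cmpLevel_apply, Ne,
    M.baseChange_etPull_cmpLevel_eq_zero_iff ℓ ι c K (Cₛ.toTower_injective ℓ hIₛ (M.src K)) y,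
    M.toTowerHom.bettiPullAlong_albMap_eq_zero_iff' cmpT cmpS hnat hinjS y]
  exact h

/-- **CLAUSE (1) FROM ONE DETECTION, per-level form** (the `S34SomeSource` clause-1 shape for the lifted receptacle of a geometric
`M : TowerHom …`). [cite: Liu2021, Thm. 4.15 proof (FJcycle.tex l. 2199–2213)] [cite: SGA4Tome3, Exp. XI Thm. 4.4] -/
theorem Sec42Data.TowerHom.baseChange_etPull_toEtaleTowerHom_comp_ne_zero_of_scheme' (M : Sec42Data.TowerHom Cₛ C Tₛ T φ hφ)
    (hIₛ : ∀ ⦃K K' : C5.SmallLevel Cₛ.S.K₀⦄ (u : K' ⟶ K), Injective (rationalTateModuleMap ℓ (Cₛ.Atr u)).dualMap)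
    {w : W} {K : C5.SmallLevel C.S.K₀} {y : C.bettiH1 τ' K} (hwy : f w = B.cmpAlong ℓ ι c (B.b K y))
    (cmpT : C.bettiH1 τ' K →ₗ[ℂ] schemeBettiH1Along (C.X K) τ')
    (cmpS : Cₛ.bettiH1 τ' (M.src K) →ₗ[ℂ] schemeBettiH1Along (Cₛ.X (M.src K)) τ')
    (hnat : ∀ y', cmpS (bettiPullAlong τ' (M.albMap K) y') = schemeBettiPullAlong τ' (M.map K) (cmpT y'))
    (hinjS : Injective cmpS) (h : schemeBettiPullAlong τ' (M.map K) (cmpT y) ≠ 0) :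
    ((M.toEtaleTowerHom.etPull ℓ).baseChange (AlgebraicClosure ℚ_[ℓ])).comp f ≠ 0 := by
  intro h0
  apply M.toEtaleTowerHom.baseChange_etPull_cmpAlong_b_ne_zero_of_scheme' B ι c hIₛ cmpT cmpS hnat hinjS h
  rw [← hwy, ← LinearMap.comp_apply, h0, LinearMap.zero_apply]

/-- **THE SPINE, per-level form**: a non-zero `f` has `(w, K, y ≠ 0)` with `f w = cmp (b_K y)` such that EVERY morphism of towers with
`hIₛ` and ANY level comparisons `(cmpT, cmpS)` natural at `Sh(φ)_K` with `cmpS` injective that detect `cmpT y` on the varieties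
satisfy `((1 ⊗ M.toEtaleTowerHom.etPull)).comp f ≠ 0`. [cite: Liu2021, Thm. 4.15 proof (FJcycle.tex l. 2199–2213) with fn. 9; §4.3 l. 2152–2165; Lem. 2.4 (1)]
[cite: MurtyRamakrishnan1992, Prop. 6 (through Liu2021 fn. 9)] [cite: SGA4Tome3, Exp. XI Thm. 4.4] -/
theorem Sec42Data.BettiPinning.exists_scheme_class_detecting' (hX : X.IsInducedBy T) (hf : f ∈ X.omegaHom ι ρW) (hf0 : f ≠ 0) :
    ∃ (w : W) (K : C5.SmallLevel C.S.K₀) (y : C.bettiH1 τ' K), y ≠ 0 ∧ f w = B.cmpAlong ℓ ι c (B.b K y) ∧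
      ∀ {P5ₛ : PropC5Data F E} {isoₛ : ℕ → Prop} {Cₛ : Sec42Data P5ₛ isoₛ} {Tₛ : Cₛ.HeckeTranslates}
        {φ : Cₛ.G →* C.G} {hφ : Continuous φ} (M : Sec42Data.TowerHom Cₛ C Tₛ T φ hφ),
        (∀ ⦃L L' : C5.SmallLevel Cₛ.S.K₀⦄ (u : L' ⟶ L), Injective (rationalTateModuleMap ℓ (Cₛ.Atr u)).dualMap) →
        ∀ (cmpT : C.bettiH1 τ' K →ₗ[ℂ] schemeBettiH1Along (C.X K) τ')
          (cmpS : Cₛ.bettiH1 τ' (M.src K) →ₗ[ℂ] schemeBettiH1Along (Cₛ.X (M.src K)) τ'),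
          (∀ y', cmpS (bettiPullAlong τ' (M.albMap K) y') = schemeBettiPullAlong τ' (M.map K) (cmpT y')) →
          Injective cmpS → schemeBettiPullAlong τ' (M.map K) (cmpT y) ≠ 0 →
            ((M.toEtaleTowerHom.etPull ℓ).baseChange (AlgebraicClosure ℚ_[ℓ])).comp f ≠ 0 := by
  obtain ⟨w, K, y, hfw, hy⟩ := B.exists_level_class_of_mem_omegaHom_ne_zero ι c hX hf hf0
  exact ⟨w, K, y, hy, hfw, fun M hIₛ cmpT cmpS hnat hinjS h =>
    M.baseChange_etPull_toEtaleTowerHom_comp_ne_zero_of_scheme' B ι c hIₛ hfw cmpT cmpS hnat hinjS h⟩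

/-! ## §5 (appended) The spine RE-LEVELLED to every finer level `K″ ⊆ K`

The closer of clause (1) shrinks the level AFTER the spine has handed `K` (the (β′) device of the GS programme: `K″ ⊴ K` with all
`g_q K″ g_q⁻¹ ⊆ K₀`, tree `C5.exists_smallLevel_le_normalised_conj_le` / `UnitaryShimuraIdentityPieceReduction`).  The level class
moves to `K″` by pull-back along `Alb(T_1)` and keeps BOTH its non-vanishing and its value under `f` — `b_{K″}(Alb(T_1)^* y) = b_K y`
(`BettiPinning.b_one`) and `b_{K″}` is injective — so §4's ∀-clause holds at `K″` with the re-levelled class.  THEOREMS ONLY. -/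

/-- **THE SPINE AT EVERY FINER LEVEL.**  A non-zero `f` has `(w, K, y ≠ 0)` with `f w = cmp (b_K y)` such that for EVERY `K″` with
`K″ ⊆ K` (`C5.HeckeLE 1 K″ K`) the re-levelled class `y″ := Alb(T_1)^* y` is non-zero, `f w = cmp (b_{K″} y″)`, and EVERY morphism of
towers with `hIₛ` and ANY natural level comparisons `(cmpT, cmpS)` at `K″` with `cmpS` injective that detect `cmpT y″` on the varieties
satisfy `((1 ⊗ M.toEtaleTowerHom.etPull)).comp f ≠ 0`. [cite: Liu2021, Thm. 4.15 proof (FJcycle.tex l. 2199–2213) with fn. 9; §4.2 l. 2070–2079; §4.3 l. 2152–2165]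
[cite: MurtyRamakrishnan1992, Prop. 6 (through Liu2021 fn. 9)] [cite: SGA4Tome3, Exp. XI Thm. 4.4] -/
theorem Sec42Data.BettiPinning.exists_scheme_class_detecting_le' (hX : X.IsInducedBy T) (hf : f ∈ X.omegaHom ι ρW)
    (hf0 : f ≠ 0) :
    ∃ (w : W) (K : C5.SmallLevel C.S.K₀) (y : C.bettiH1 τ' K), y ≠ 0 ∧ f w = B.cmpAlong ℓ ι c (B.b K y) ∧
      ∀ (K'' : C5.SmallLevel C.S.K₀) (hle : C5.HeckeLE (1 : C.G) K'' K),
        bettiPullAlong τ' (T.albTr 1 K'' K hle) y ≠ 0 ∧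
        f w = B.cmpAlong ℓ ι c (B.b K'' (bettiPullAlong τ' (T.albTr 1 K'' K hle) y)) ∧
        ∀ {P5ₛ : PropC5Data F E} {isoₛ : ℕ → Prop} {Cₛ : Sec42Data P5ₛ isoₛ} {Tₛ : Cₛ.HeckeTranslates}
          {φ : Cₛ.G →* C.G} {hφ : Continuous φ} (M : Sec42Data.TowerHom Cₛ C Tₛ T φ hφ),
          (∀ ⦃L L' : C5.SmallLevel Cₛ.S.K₀⦄ (u : L' ⟶ L), Injective (rationalTateModuleMap ℓ (Cₛ.Atr u)).dualMap) →
          ∀ (cmpT : C.bettiH1 τ' K'' →ₗ[ℂ] schemeBettiH1Along (C.X K'') τ')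
            (cmpS : Cₛ.bettiH1 τ' (M.src K'') →ₗ[ℂ] schemeBettiH1Along (Cₛ.X (M.src K'')) τ'),
            (∀ y', cmpS (bettiPullAlong τ' (M.albMap K'') y') = schemeBettiPullAlong τ' (M.map K'') (cmpT y')) →
            Injective cmpS →
              schemeBettiPullAlong τ' (M.map K'') (cmpT (bettiPullAlong τ' (T.albTr 1 K'' K hle) y)) ≠ 0 →
                ((M.toEtaleTowerHom.etPull ℓ).baseChange (AlgebraicClosure ℚ_[ℓ])).comp f ≠ 0 := by
  obtain ⟨w, K, y, hfw, hy⟩ := B.exists_level_class_of_mem_omegaHom_ne_zero ι c hX hf hf0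
  refine ⟨w, K, y, hy, hfw, fun K'' hle => ?_⟩
  -- re-levelling keeps the value under `b` (hence under `f`) and the non-vanishing
  have hb : B.b K'' (bettiPullAlong τ' (T.albTr 1 K'' K hle) y) = B.b K y := (B.b_one K'' K hle y).symm
  have hfw'' : f w = B.cmpAlong ℓ ι c (B.b K'' (bettiPullAlong τ' (T.albTr 1 K'' K hle) y)) := by rw [hb]; exact hfw
  have hy'' : bettiPullAlong τ' (T.albTr 1 K'' K hle) y ≠ 0 := by
    intro h0
    apply hy
    apply B.b_injective K
    rw [← hb, h0, map_zero, map_zero]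
  exact ⟨hy'', hfw'', fun M hIₛ cmpT cmpS hnat hinjS h =>
    M.baseChange_etPull_toEtaleTowerHom_comp_ne_zero_of_scheme' B ι c hIₛ hfw'' cmpT cmpS hnat hinjS h⟩

end Literature.NumberTheory.Automorphic.Liu2021.AppendixC

end

/-! ## §6 (appended) RE-ENTRY ALONG A HECKE TRANSLATE `T_g`: the spine at the conjugate level

The closer of clause (1) moves the detected class to the IDENTITY piece of a CONJUGATE level `Λ = gK″g⁻¹ ∩ K₀` along the Hecke
translate `T_g : X_Λ ⟶ X_{K″}` (the (β′) device of the GS programme; tree `UnitaryShimuraIdentityPieceReduction`).  On the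
Hom-space side this is free: `f ∈ Hom_{ℚ_ℓ^{ac}[𝔾]}(ι∘ω, ℚ_ℓ^{ac} ⊗ H¹_ét(A_∞))` intertwines `ρ_ω(g)` with `X.rhoEt g ⊗ 1`
(`EtaleHeckeDatum.omegaHom`, [Liu2021] §4.3 l. 2162–2165), the comparison intertwines `rhoB g` with `X.rhoEt g ⊗ 1`
(`BettiPinning.cmpAlong_rhoB`, `X` induced by `T`), and `rhoB g` is `Alb(T_g)^*` on the levels (`BettiPinning.b_hecke`); hence
`f (ρ_ω(g) w) = cmp (b_Λ (Alb(T_g)^* y″))` — the value of `f` at the translated vector is the level-`Λ` class `Alb(T_g)^* y″`, and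
§4's ∀-clause applies AT `Λ` to that class.  THEOREMS ONLY; no face / GS import. -/

noncomputable section

open CategoryTheory NumberField Function
open scoped TensorProduct

namespace Literature.NumberTheory.Automorphic.Liu2021.AppendixC

open Literature.AlgebraicGeometry.Motives (AbelianVariety)
open Literature.AlgebraicGeometry.Motives.AbelianVariety (rationalTateModuleMap)

variable {F E : Type} [Field F] [NumberField F] [IsTotallyReal F] [Field E] [NumberField E] [Algebra F E]
  [IsTotallyComplex E] [Algebra.IsQuadraticExtension F E]
variable {P5ₛ P5 : PropC5Data F E} {isoₛ iso : ℕ → Prop}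
variable {Cₛ : Sec42Data P5ₛ isoₛ} {C : Sec42Data P5 iso} {Tₛ : Cₛ.HeckeTranslates} {T : C.HeckeTranslates}
  {φ : Cₛ.G →* C.G} {hφ : Continuous φ} {ℓ : ℕ} [Fact ℓ.Prime] {X : C.EtaleHeckeDatum ℓ}
variable {τ' : E →+* ℂ} {H : Type} [AddCommGroup H] [Module ℂ H] {rhoB : Representation ℂ C.G H}
  (B : C.BettiPinning T τ' H rhoB) (ι : ℂ ≃+* AlgebraicClosure ℚ_[ℓ]) (c : H1ComparisonFamily (E := E) τ' ℓ ι)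
variable {W : Type} [AddCommGroup W] [Module ℂ W] {ρW : Representation ℂ C.G W}
  {f : W →ₛₗ[(ι : ℂ →+* AlgebraicClosure ℚ_[ℓ])] AlgebraicClosure ℚ_[ℓ] ⊗[ℚ_[ℓ]] C.etaleH1Tower ℓ}

/-- **L5 — the value of `f` at a translated vector.**  If `f ∈ Hom_{ℚ_ℓ^{ac}[𝔾]}(ι∘ω, ℚ_ℓ^{ac} ⊗ H¹_ét(A_∞))` (`X` induced by
`T`) takes the value `cmp (b_{K′} y)` at `w`, then at `ρ_ω(g) w` it takes the value `cmp (b_K (Alb(T_g)^* y))` for every level `K`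
with `g⁻¹Kg ⊆ K′`: `f (ρ_ω(g) w) = (X.rhoEt g ⊗ 1)(f w)` (Hom-space equivariance), `= cmp (rhoB g (b_{K′} y))` (`cmpAlong_rhoB`),
`= cmp (b_K (Alb(T_g)^* y))` (`b_hecke`). [cite: Liu2021, §4.3 (FJcycle.tex l. 2160–2165); §4.2 l. 2070–2074; Thm. 4.15 proof l. 2199–2213]
[cite: Milne2005ShimuraVarieties, Thm. 13.6 p. 118] -/
theorem Sec42Data.BettiPinning.apply_rho_eq_cmpAlong_b_albTr (hX : X.IsInducedBy T) (hf : f ∈ X.omegaHom ι ρW)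
    {w : W} {K K' : C5.SmallLevel C.S.K₀} {y : C.bettiH1 τ' K'} (hwy : f w = B.cmpAlong ℓ ι c (B.b K' y))
    (g : C.G) (h : C5.HeckeLE g K K') :
    f (ρW g w) = B.cmpAlong ℓ ι c (B.b K (bettiPullAlong τ' (T.albTr g K K' h) y)) := by
  rw [(X.mem_omegaHom_iff ι ρW f).1 hf g w, hwy, ← B.cmpAlong_rhoB ℓ ι c hX g, B.b_hecke g K K' h y]

/-- **CLAUSE (1) FROM ONE DETECTION AT THE CONJUGATE LEVEL** (per-level comparisons): if `f w = cmp (b_{K′} y)`, `g⁻¹Λg ⊆ K′`, and a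
morphism of towers `M` with `hIₛ`, natural level comparisons `(cmpT, cmpS)` at `Λ` with `cmpS` injective DETECTS the translated class
`cmpT (Alb(T_g)^* y)` on the varieties at level `Λ`, then `((1 ⊗ M.toEtaleTowerHom.etPull)).comp f ≠ 0` — §4 at the vector `ρ_ω(g) w`.
[cite: Liu2021, Thm. 4.15 proof (FJcycle.tex l. 2199–2213); §4.3 l. 2160–2165] [cite: SGA4Tome3, Exp. XI Thm. 4.4] -/
theorem Sec42Data.TowerHom.baseChange_etPull_toEtaleTowerHom_comp_ne_zero_of_scheme_hecke (M : Sec42Data.TowerHom Cₛ C Tₛ T φ hφ)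
    (hIₛ : ∀ ⦃K K' : C5.SmallLevel Cₛ.S.K₀⦄ (u : K' ⟶ K), Injective (rationalTateModuleMap ℓ (Cₛ.Atr u)).dualMap)
    (hX : X.IsInducedBy T) (hf : f ∈ X.omegaHom ι ρW)
    {w : W} {Λ K' : C5.SmallLevel C.S.K₀} {y : C.bettiH1 τ' K'} (hwy : f w = B.cmpAlong ℓ ι c (B.b K' y))
    (g : C.G) (h : C5.HeckeLE g Λ K')
    (cmpT : C.bettiH1 τ' Λ →ₗ[ℂ] schemeBettiH1Along (C.X Λ) τ')
    (cmpS : Cₛ.bettiH1 τ' (M.src Λ) →ₗ[ℂ] schemeBettiH1Along (Cₛ.X (M.src Λ)) τ')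
    (hnat : ∀ y', cmpS (bettiPullAlong τ' (M.albMap Λ) y') = schemeBettiPullAlong τ' (M.map Λ) (cmpT y'))
    (hinjS : Injective cmpS)
    (hdet : schemeBettiPullAlong τ' (M.map Λ) (cmpT (bettiPullAlong τ' (T.albTr g Λ K' h) y)) ≠ 0) :
    ((M.toEtaleTowerHom.etPull ℓ).baseChange (AlgebraicClosure ℚ_[ℓ])).comp f ≠ 0 :=
  M.baseChange_etPull_toEtaleTowerHom_comp_ne_zero_of_scheme' B ι c hIₛ
    (B.apply_rho_eq_cmpAlong_b_albTr ι c hX hf hwy g h) cmpT cmpS hnat hinjS hdet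

/-- **THE SPINE WITH HECKE RE-ENTRY.**  A non-zero `f` has `(w, K, y ≠ 0)` with `f w = cmp (b_K y)` such that for EVERY finer level
`K″ ⊆ K` (re-levelled class `y″ := Alb(T_1)^* y ≠ 0`, `f w = cmp (b_{K″} y″)`) and EVERY `g`, `Λ` with `g⁻¹Λg ⊆ K″`: the translated
vector `ρ_ω(g) w` has the value `cmp (b_Λ (Alb(T_g)^* y″))`, and EVERY morphism of towers with `hIₛ` and ANY natural level comparisons
`(cmpT, cmpS)` at `Λ` with `cmpS` injective that detect `cmpT (Alb(T_g)^* y″)` on the varieties satisfy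
`((1 ⊗ M.toEtaleTowerHom.etPull)).comp f ≠ 0`.  (§5 + L5: the (β′) move `K″ ↦ Λ = gK″g⁻¹ ∩ K₀` of the closer costs nothing on the
Hom-space side.) [cite: Liu2021, Thm. 4.15 proof (FJcycle.tex l. 2199–2213) with fn. 9; §4.2 l. 2070–2079; §4.3 l. 2152–2165]
[cite: MurtyRamakrishnan1992, Prop. 6 (through Liu2021 fn. 9)] [cite: Milne2005ShimuraVarieties, Thm. 13.6 p. 118] [cite: SGA4Tome3, Exp. XI Thm. 4.4] -/
theorem Sec42Data.BettiPinning.exists_scheme_class_detecting_hecke' (hX : X.IsInducedBy T) (hf : f ∈ X.omegaHom ι ρW)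
    (hf0 : f ≠ 0) :
    ∃ (w : W) (K : C5.SmallLevel C.S.K₀) (y : C.bettiH1 τ' K), y ≠ 0 ∧ f w = B.cmpAlong ℓ ι c (B.b K y) ∧
      ∀ (K'' : C5.SmallLevel C.S.K₀) (hle : C5.HeckeLE (1 : C.G) K'' K),
        bettiPullAlong τ' (T.albTr 1 K'' K hle) y ≠ 0 ∧
        f w = B.cmpAlong ℓ ι c (B.b K'' (bettiPullAlong τ' (T.albTr 1 K'' K hle) y)) ∧
        ∀ (g : C.G) (Λ : C5.SmallLevel C.S.K₀) (h : C5.HeckeLE g Λ K''),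
          f (ρW g w) = B.cmpAlong ℓ ι c (B.b Λ
            (bettiPullAlong τ' (T.albTr g Λ K'' h) (bettiPullAlong τ' (T.albTr 1 K'' K hle) y))) ∧
          ∀ {P5ₛ : PropC5Data F E} {isoₛ : ℕ → Prop} {Cₛ : Sec42Data P5ₛ isoₛ} {Tₛ : Cₛ.HeckeTranslates}
            {φ : Cₛ.G →* C.G} {hφ : Continuous φ} (M : Sec42Data.TowerHom Cₛ C Tₛ T φ hφ),
            (∀ ⦃L L' : C5.SmallLevel Cₛ.S.K₀⦄ (u : L' ⟶ L), Injective (rationalTateModuleMap ℓ (Cₛ.Atr u)).dualMap) →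
            ∀ (cmpT : C.bettiH1 τ' Λ →ₗ[ℂ] schemeBettiH1Along (C.X Λ) τ')
              (cmpS : Cₛ.bettiH1 τ' (M.src Λ) →ₗ[ℂ] schemeBettiH1Along (Cₛ.X (M.src Λ)) τ'),
              (∀ y', cmpS (bettiPullAlong τ' (M.albMap Λ) y') = schemeBettiPullAlong τ' (M.map Λ) (cmpT y')) →
              Injective cmpS →
                schemeBettiPullAlong τ' (M.map Λ)
                    (cmpT (bettiPullAlong τ' (T.albTr g Λ K'' h) (bettiPullAlong τ' (T.albTr 1 K'' K hle) y))) ≠ 0 →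
                  ((M.toEtaleTowerHom.etPull ℓ).baseChange (AlgebraicClosure ℚ_[ℓ])).comp f ≠ 0 := by
  obtain ⟨w, K, y, hy, hfw, hall⟩ := B.exists_scheme_class_detecting_le' ι c hX hf hf0
  refine ⟨w, K, y, hy, hfw, fun K'' hle => ?_⟩
  obtain ⟨hy'', hfw'', -⟩ := hall K'' hle
  exact ⟨hy'', hfw'', fun g Λ h => ⟨B.apply_rho_eq_cmpAlong_b_albTr ι c hX hf hfw'' g h,
    fun M hIₛ cmpT cmpS hnat hinjS hdet =>
      M.baseChange_etPull_toEtaleTowerHom_comp_ne_zero_of_scheme_hecke B ι c hIₛ hX hf hfw'' g h cmpT cmpS hnat hinjS hdet⟩⟩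

end Literature.NumberTheory.Automorphic.Liu2021.AppendixC

end
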